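import Mathlib
import Summits.Ventures.PercRepro2.HCov
import Summits.Ventures.PercRepro2.HCovSwap
import Summits.Ventures.PercRepro2.GcSkelReductionMin
import Summits.Ventures.PercRepro2.GcSkelReductionActive
import Summits.Ventures.PercRepro2.GcSkelReductionZ
import Summits.Ventures.PercRepro2.GcSkelSwap
import Summits.Ventures.PercRepro2.GcInterior
import Summits.Ventures.PercRepro2.GcInteriorPos
import Summits.Ventures.PercRepro2.GcInteriorDo
import Summits.Ventures.PercRepro2.GcRational

/-!
# Normalising the root order on the class of record (blind cell PercRepro2, typer-1 g56)

The class of record is symmetric in the roots (`wredMinHAZ_swap`, GcSkelSwap.lean) and so is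
(HCOV) (`HCov_swap`), so any property of an instance that holds in one root order may be assumed
WITHOUT LOSS OF GENERALITY. Two normalisations:

* **structural** — on the residual `o ↔ a₁` in `G − {a₂, a₃}` or `o ↔ a₂` in `G − {a₁, a₃}`
  (`conn_sepConfig_pair_of_wredI`, g55); WLOG the second: `HCovWRedMinHAZo_int_all` quantifies
  over the class of record at interior weights with `o ↔ a₂` in `G − {a₁, a₃}`, and
  **`HCov_all_iff_HCovWRedMinHAZo_int_all`**. There the configuration with exactly the edges off
  `{a₁, a₃}` open lies in `PD ∩ {o ∈ C₂}`, so **`PD_oH_pos_of_conn`**: `P(PD, o ∈ C₂) > 0`, and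
  with `D > 0` the margin is STRICTLY positive, **`marginC_pos_of_conn`** — the two terms
  `P(PD, o ∈ C₂)` and `marginC` are positive on the normalised class (the masses g55 could not
  sign without the normalisation);
* **the labelling gap** — `gap p ends a₂ a₁ b = −gap p ends a₁ a₂ b` (`gap_swap`); WLOG
  `0 ≤ gap` (`a₂` the root better connected to `b`): `HCovWRedMinHAZg_int_all` and
  **`HCov_all_iff_HCovWRedMinHAZg_int_all`**.

Both over the rationals as well (`HCov_all_real_iff_HCovWRedMinHAZo_int_all_rat`,
`HCov_all_real_iff_HCovWRedMinHAZg_int_all_rat`). Standard axioms.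
-/

namespace Summit.Ventures.PercRepro2

open CovForm RECM SepPair

namespace WRed

/-! ## The gap under the swap -/

section Gap

variable {V : Type*} {E : Type*} [Fintype E] [DecidableEq E] {R : Type*} [Field R]

/-- The labelling gap changes sign under the root swap. -/
lemma gap_swap (p : E → R) (ends : E → Sym2 V) (a₁ a₂ b : V) :
    gap p ends a₂ a₁ b = -gap p ends a₁ a₂ b := by
  unfold gap
  ring

end Gap

/-! ## The closures -/

section Closures

variable (R : Type*) [Field R] [LinearOrder R] [IsStrictOrderedRing R]

/-- **(HCOV) on the class of record at interior weights, `o ↔ a₂` in `G − {a₁, a₃}`.** -/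
def HCovWRedMinHAZo_int_all : Prop :=
  ∀ (V E : Type) [Fintype V] [DecidableEq V] [Fintype E] [DecidableEq E]
    (ends : E → Sym2 V) (p : E → R), IsIntVec p →
    ∀ o a₁ a₂ a₃ b : V, a₁ ≠ a₂ → a₁ ≠ a₃ → a₂ ≠ a₃ → o ≠ a₁ → o ≠ a₂ → o ≠ a₃ → o ≠ b →
      b ≠ a₁ → b ≠ a₂ → b ≠ a₃ → WReducedMinHAZ ends o a₁ a₂ a₃ b →
      Conn ends (sepConfig ends {a₁, a₃}) o a₂ → HCov p ends o a₁ a₂ a₃ b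

/-- **(HCOV) on the class of record at interior weights with a nonnegative labelling gap.** -/
def HCovWRedMinHAZg_int_all : Prop :=
  ∀ (V E : Type) [Fintype V] [DecidableEq V] [Fintype E] [DecidableEq E]
    (ends : E → Sym2 V) (p : E → R), IsIntVec p →
    ∀ o a₁ a₂ a₃ b : V, a₁ ≠ a₂ → a₁ ≠ a₃ → a₂ ≠ a₃ → o ≠ a₁ → o ≠ a₂ → o ≠ a₃ → o ≠ b →
      b ≠ a₁ → b ≠ a₂ → b ≠ a₃ → WReducedMinHAZ ends o a₁ a₂ a₃ b →
      0 ≤ gap p ends a₁ a₂ b → HCov p ends o a₁ a₂ a₃ b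

end Closures

section Main

variable {R : Type*} [Field R] [LinearOrder R] [IsStrictOrderedRing R]

omit [IsStrictOrderedRing R] in
/-- The normalised closure gives the closure: the other root order is the swapped instance. -/
theorem HCovWRedMinHAZ_int_all_of_o (h : HCovWRedMinHAZo_int_all R) :
    HCovWRedMinHAZ_int_all R := by
  intro V E _ _ _ _ ends p hp o a₁ a₂ a₃ b h12 h13 h23 ho1 ho2 ho3 hob hb1 hb2 hb3 hred
  have hI : WReducedI ends o a₁ a₂ a₃ b :=
    (wredT_iff_wredMin.2 hred.toWReducedMin).toWReducedI
  rcases conn_sepConfig_pair_of_wredI hI h12 h13 h23 ho1 ho2 ho3 hob hb1 hb2 hb3 with hc | hc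
  · exact (HCov_swap p ends o a₁ a₂ a₃ b).1
      (h V E ends p hp o a₂ a₁ a₃ b h12.symm h23 h13 ho2 ho1 ho3 hob hb2 hb1 hb3
        (wredMinHAZ_swap hred) hc)
  · exact h V E ends p hp o a₁ a₂ a₃ b h12 h13 h23 ho1 ho2 ho3 hob hb1 hb2 hb3 hred hc

omit [IsStrictOrderedRing R] in
/-- The two closures agree. -/
theorem HCovWRedMinHAZ_int_all_iff_o : HCovWRedMinHAZ_int_all R ↔ HCovWRedMinHAZo_int_all R :=
  ⟨fun h V E _ _ _ _ ends p hp o a₁ a₂ a₃ b h12 h13 h23 ho1 ho2 ho3 hob hb1 hb2 hb3 hred _ =>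
      h V E ends p hp o a₁ a₂ a₃ b h12 h13 h23 ho1 ho2 ho3 hob hb1 hb2 hb3 hred,
    HCovWRedMinHAZ_int_all_of_o⟩

/-- **THE CRUX ON THE CLASS OF RECORD, `o ↔ a₂` OFF `{a₁, a₃}` WITHOUT LOSS OF GENERALITY.** -/
theorem HCov_all_iff_HCovWRedMinHAZo_int_all : HCov_all R ↔ HCovWRedMinHAZo_int_all R :=
  HCov_all_iff_HCovWRedMinHAZ_int_all.trans HCovWRedMinHAZ_int_all_iff_o

/-- The gap-normalised closure gives the closure: a negative gap is positive in the other root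
order. -/
theorem HCovWRedMinHAZ_int_all_of_g (h : HCovWRedMinHAZg_int_all R) :
    HCovWRedMinHAZ_int_all R := by
  intro V E _ _ _ _ ends p hp o a₁ a₂ a₃ b h12 h13 h23 ho1 ho2 ho3 hob hb1 hb2 hb3 hred
  by_cases hg : 0 ≤ gap p ends a₁ a₂ b
  · exact h V E ends p hp o a₁ a₂ a₃ b h12 h13 h23 ho1 ho2 ho3 hob hb1 hb2 hb3 hred hg
  · have hg' : 0 ≤ gap p ends a₂ a₁ b := by
      rw [gap_swap]
      exact neg_nonneg.2 (le_of_lt (not_le.1 hg))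
    exact (HCov_swap p ends o a₁ a₂ a₃ b).1
      (h V E ends p hp o a₂ a₁ a₃ b h12.symm h23 h13 ho2 ho1 ho3 hob hb2 hb1 hb3
        (wredMinHAZ_swap hred) hg')

/-- The two closures agree. -/
theorem HCovWRedMinHAZ_int_all_iff_g : HCovWRedMinHAZ_int_all R ↔ HCovWRedMinHAZg_int_all R :=
  ⟨fun h V E _ _ _ _ ends p hp o a₁ a₂ a₃ b h12 h13 h23 ho1 ho2 ho3 hob hb1 hb2 hb3 hred _ =>
      h V E ends p hp o a₁ a₂ a₃ b h12 h13 h23 ho1 ho2 ho3 hob hb1 hb2 hb3 hred,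
    HCovWRedMinHAZ_int_all_of_g⟩

/-- **THE CRUX ON THE CLASS OF RECORD WITH A NONNEGATIVE LABELLING GAP.** -/
theorem HCov_all_iff_HCovWRedMinHAZg_int_all : HCov_all R ↔ HCovWRedMinHAZg_int_all R :=
  HCov_all_iff_HCovWRedMinHAZ_int_all.trans HCovWRedMinHAZ_int_all_iff_g

end Main

section Real

/-- The structural normalisation over the rationals. -/
theorem HCov_all_real_iff_HCovWRedMinHAZo_int_all_rat :
    HCov_all ℝ ↔ HCovWRedMinHAZo_int_all ℚ :=
  HCov_all_real_iff_rat.trans (HCov_all_iff_HCovWRedMinHAZo_int_all (R := ℚ))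

/-- The gap normalisation over the rationals. -/
theorem HCov_all_real_iff_HCovWRedMinHAZg_int_all_rat :
    HCov_all ℝ ↔ HCovWRedMinHAZg_int_all ℚ :=
  HCov_all_real_iff_rat.trans (HCov_all_iff_HCovWRedMinHAZg_int_all (R := ℚ))

end Real

/-! ## The masses on the normalised class -/

section Masses

variable {V : Type*} {E : Type*} [Fintype V] [DecidableEq V] [Fintype E] [DecidableEq E]
  {R : Type*} [Field R] [LinearOrder R] [IsStrictOrderedRing R]

omit [Fintype V] [DecidableEq V] in
/-- **`P(PD, o ∈ C₂) > 0`** at interior weights when `o ↔ a₂` in `G − {a₁, a₃}`: the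
configuration with exactly the edges off `{a₁, a₃}` open is in `PD ∩ {o ∈ C₂}`. -/
theorem PD_oH_pos_of_conn {p : E → R} (hp : IsIntVec p) {ends : E → Sym2 V} {o a₁ a₂ a₃ : V}
    (h12 : a₁ ≠ a₂) (h13 : a₁ ≠ a₃) (h23 : a₂ ≠ a₃)
    (hc : Conn ends (sepConfig ends {a₁, a₃}) o a₂) :
    0 < prob p (PDEvent ends a₁ a₂ a₃ ∩ connEvent ends a₂ o) := by
  have hmem := sepConfig_pair_mem_PD_conn h12.symm h23 h13 hc
  rw [PDEvent_root_swap] at hmem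
  exact prob_pos_of_int hp ⟨_, hmem⟩

/-- **The margin is strictly positive** at interior weights when `o ↔ a₂` in `G − {a₁, a₃}`:
`marginC ≥ 2 · D · P(PD, o ∈ C₂) > 0` (the margin identity, the BHK bracket nonnegative). -/
theorem marginC_pos_of_conn {p : E → R} (hp : IsIntVec p) {ends : E → Sym2 V} {o a₁ a₂ a₃ : V}
    (h12 : a₁ ≠ a₂) (h13 : a₁ ≠ a₃) (h23 : a₂ ≠ a₃)
    (hc : Conn ends (sepConfig ends {a₁, a₃}) o a₂) : 0 < marginC p ends o a₁ a₂ a₃ := by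
  have hp' := hp.isProbVec
  rw [margin_identity]
  have h := ToL_mul_D_le p hp' ends o a₁ a₂ a₃
  have hD := PD_pos_of_int hp ends h12 h13 h23
  have hT := prob_nonneg hp' (TEvent ends a₁ a₂ a₃)
  have hoH := PD_oH_pos_of_conn hp h12 h13 h23 hc
  have hoH' := prob_nonneg hp' (TEvent ends a₂ a₁ a₃ ∩ connEvent ends a₂ o)
  have hDo : prob p (PDEvent ends a₁ a₂ a₃ ∩ connEvent ends a₁ o) ≤ Do p ends o a₁ a₂ a₃ := by
    unfold Do
    linarith
  have h2 : prob p (PDEvent ends a₁ a₂ a₃ ∩ connEvent ends a₁ o) * prob p (TEvent ends a₁ a₂ a₃) ≤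
      Do p ends o a₁ a₂ a₃ * prob p (TEvent ends a₁ a₂ a₃) :=
    mul_le_mul_of_nonneg_right hDo hT
  nlinarith [h, h2, mul_pos hD hoH, mul_nonneg hD.le hoH']

end Masses

end WRed

end Summit.Ventures.PercRepro2
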